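import Mathlib
import HarnessLib
import Literature.Dynamics.Hyperbolic.RGFlowStableManifold

/-!
# The fine-tuning theorem with the irrelevant coordinates measured by NORM-BOUND PREDICATES
# (Brydges 2009, Thm 2.16 / [ABKM19] Thm 12.1 — existence, reduced to the relevant trajectory)

`RGFlowStableManifold.exists_isTrajectory` treats the scale recursion
`x_{k+1} = A_k x_k + B_k y_k`, `y_{k+1} = S_k(x_k, y_k)`, `y_0` given, `x_N = 0`, with BOTH
coordinates in Banach spaces.  In the gradient renormalisation group of [ABKM19] the irrelevant
coordinates `y_k = K_k` (polymer activities) are measured in the tree by norm-bound PREDICATES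
(`GradientRG.WeakNormLE P k K C`, "‖K‖_k^{(A)} ≤ C") rather than by the norm of a Banach space,
while the relevant coordinates `x_k = H_k` live in a finite-dimensional (hence complete) space.
This file proves the same existence theorem in that format, by the reduction noted in
[ABKM19] Ch. 12 (the relevant equation is LINEAR and solved backwards; the irrelevant coordinates
are then FUNCTIONS of the relevant trajectory by the forward recursion): the unknown is the
relevant trajectory `(x_k)_{k ≤ N}` alone, a point of the Banach space `Π_{k ≤ N} E_k` (sup norm in
the rescaled coordinates `u_k = η^{−k} x_k`), and the operator
`(𝒯u)_k = A_k⁻¹ (η u_{k+1} − η^{−k} B_k y_k(u))`, `(𝒯u)_N = 0`, with `y(u)` the forward solution, is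
a `κ`-contraction of the closed `ε`-ball — Banach's fixed-point theorem
(`exists_fixedPt_of_lipschitz_of_norm_le`) gives the tuned trajectory.

* `RGFlow.IsNormBound Q` — the axioms used of the predicates `Q k y c` ("‖y‖_k ≤ c"): monotone in
  `c`, and `Q k 0 0`;
* `RGFlow.IsRGStepQ N r α β σ Q A B S` — the hypotheses on the steps in predicate form:
  `S_k(0,0) = 0`, the Lipschitz bound `‖S_k(x,y) − S_k(x',y')‖_{k+1} ≤ σ max(‖x−x'‖, ‖y−y'‖_k)` on
  the `r`-ball, `‖A_k⁻¹‖ ≤ α`, `‖B_k y‖ ≤ β ‖y‖_k`;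
* `RGFlow.fwd S y₀ x` — the forward (irrelevant) recursion; `RGFlow.redMap` — the operator `𝒯`;
* **`RGFlow.exists_tuned_of_normBound`** — for `α(η+β) ≤ κ < 1`, `σ ≤ κη`, `0 < η ≤ 1`, `ε ≤ r`
  and `‖y_0‖_0 ≤ ε`: there is a relevant trajectory `x` with `x_N = 0`,
  `x_{k+1} = A_k x_k + B_k y_k`, `y = fwd S y₀ x`, `‖x_k‖ ≤ ε η^k` and `‖y_k‖_k ≤ ε η^k` (`k ≤ N`).

Everything is proved; no named fact.  Not here: uniqueness, Lipschitz dependence on parameters and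
the second fixed point (Lemma 12.6) in this format.

## References
* D. C. Brydges, IAS/Park City Math. Ser. 16 (2009), §2.10, Theorem 2.16 [Brydges2009].
* S. Adams, S. Buchholz, R. Kotecký, S. Müller, arXiv:1910.13564, Ch. 12, (12.1)–(12.9),
  Theorem 12.1, (12.43)–(12.48) [AdamsBuchholzKoteckyMuller2019].
-/

noncomputable section

open Set Function Metric Filter
open scoped NNReal Topology

namespace Literature.Dynamics.Hyperbolic

namespace RGFlow

/-! ## §0 The forward recursion -/

section Fwd

variable {E F : ℕ → Type*}

/-- **The forward (irrelevant) recursion** `y_0 = y₀`, `y_{k+1} = S_k(x_k, y_k)` driven by a relevant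
trajectory `x`. [cite: AdamsBuchholzKoteckyMuller2019, Ch. 12, eq. (12.7)] -/
def fwd (S : ∀ k, E k → F k → F (k + 1)) (y₀ : F 0) (x : ∀ k, E k) : (k : ℕ) → F k
  | 0 => y₀
  | k + 1 => S k (x k) (fwd S y₀ x k)

/-- `y_0 = y₀`. [cite: AdamsBuchholzKoteckyMuller2019, Ch. 12, eq. (12.3)] -/
@[simp] theorem fwd_zero (S : ∀ k, E k → F k → F (k + 1)) (y₀ : F 0) (x : ∀ k, E k) :
    fwd S y₀ x 0 = y₀ := rfl

/-- `y_{k+1} = S_k(x_k, y_k)`. [cite: AdamsBuchholzKoteckyMuller2019, Ch. 12, eq. (12.7)] -/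
@[simp] theorem fwd_succ (S : ∀ k, E k → F k → F (k + 1)) (y₀ : F 0) (x : ∀ k, E k) (k : ℕ) :
    fwd S y₀ x (k + 1) = S k (x k) (fwd S y₀ x k) := rfl

end Fwd

variable {E : ℕ → Type*} [∀ k, NormedAddCommGroup (E k)] [∀ k, NormedSpace ℝ (E k)]
  {F : ℕ → Type*} [∀ k, AddCommGroup (F k)]

/-! ## §1 Norm-bound predicates and the hypotheses on the steps -/

/-- The two properties of the norm-bound predicates `Q k y c` ("the scale-`k` norm of `y` is at
most `c`") used by the contraction argument: monotonicity in the bound and `‖0‖_k ≤ 0`.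
[cite: AdamsBuchholzKoteckyMuller2019, Ch. 12, eq. (12.2)] -/
structure IsNormBound (Q : ∀ k, F k → ℝ → Prop) : Prop where
  /-- a larger constant is still a bound -/
  mono : ∀ k (y : F k) (c c' : ℝ), Q k y c → c ≤ c' → Q k y c'
  /-- the zero activity has norm `0` -/
  zero : ∀ k, Q k (0 : F k) 0

/-- Hypotheses on the RG steps `T_k(x,y) = (A_k x + B_k y, S_k(x,y))`, `k < N`, with the irrelevant
coordinates measured by the predicates `Q`: `S_k(0,0) = 0`; the Lipschitz bound of `S_k` on the
`r`-ball, `‖S_k(x,y) − S_k(x',y')‖_{k+1} ≤ σ max(‖x − x'‖, ‖y − y'‖_k)`; `‖A_k⁻¹‖ ≤ α`; `‖B_k y‖ ≤ β‖y‖_k`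
([ABKM19] Thm 6.7/6.8 in the form used in Ch. 12).
[cite: AdamsBuchholzKoteckyMuller2019, Thm 6.8] -/
structure IsRGStepQ (N : ℕ) (r α β σ : ℝ) (Q : ∀ k, F k → ℝ → Prop)
    (A : ∀ k, E k ≃L[ℝ] E (k + 1)) (B : ∀ k, F k →+ E (k + 1))
    (S : ∀ k, E k → F k → F (k + 1)) : Prop where
  /-- the origin is a fixed point of every step -/
  map_zero : ∀ k, k < N → S k 0 0 = 0
  /-- `S_k` is `σ`-Lipschitz on the `r`-ball, in predicate form -/
  lipschitz : ∀ k, k < N → ∀ (x x' : E k) (y y' : F k) (cy cy' c : ℝ),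
    ‖x‖ ≤ r → ‖x'‖ ≤ r → Q k y cy → cy ≤ r → Q k y' cy' → cy' ≤ r → Q k (y - y') c →
      Q (k + 1) (S k x y - S k x' y') (σ * max ‖x - x'‖ c)
  /-- `‖A_k⁻¹‖ ≤ α` -/
  norm_symm_le : ∀ k, k < N → ∀ w : E (k + 1), ‖(A k).symm w‖ ≤ α * ‖w‖
  /-- `‖B_k y‖ ≤ β ‖y‖_k` -/
  norm_B_le : ∀ k, k < N → ∀ (y : F k) (c : ℝ), Q k y c → ‖B k y‖ ≤ β * c

/-! ## §2 The trajectory space and the operator -/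

/-- The space of rescaled relevant trajectories `u = (u_k)_{k ≤ N}`, `u_k = η^{−k} x_k`, sup norm.
[cite: AdamsBuchholzKoteckyMuller2019, Ch. 12, eq. (12.1)] -/
abbrev ETraj (E : ℕ → Type*) [∀ k, NormedAddCommGroup (E k)] (N : ℕ) : Type _ :=
  ∀ k : Fin (N + 1), E k

/-- The coordinate `u_k` (`0` beyond the horizon). [folklore] -/
def uAt' (N : ℕ) (z : ETraj E N) (k : ℕ) : E k :=
  if h : k < N + 1 then z ⟨k, h⟩ else 0

/-- The relevant trajectory `x_k = η^k u_k` of a rescaled trajectory.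
[cite: AdamsBuchholzKoteckyMuller2019, Ch. 12, eq. (12.2)] -/
def xOf (N : ℕ) (η : ℝ) (z : ETraj E N) (k : ℕ) : E k := η ^ k • uAt' N z k

/-- **The reduced operator `𝒯`**: `(𝒯u)_k = A_k⁻¹ (η u_{k+1} − η^{−k} B_k y_k(u))` for `k < N`,
`(𝒯u)_N = 0`, where `y(u) = fwd S y₀ (x(u))` is the forward solution.
[cite: AdamsBuchholzKoteckyMuller2019, Ch. 12, eqs. (12.4)–(12.6)] -/
def redMap (N : ℕ) (η : ℝ) (A : ∀ k, E k ≃L[ℝ] E (k + 1)) (B : ∀ k, F k →+ E (k + 1))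
    (S : ∀ k, E k → F k → F (k + 1)) (y₀ : F 0) (z : ETraj E N) : ETraj E N :=
  fun k => if (k : ℕ) < N then
    (A k).symm (η • uAt' N z (k + 1) - (η ^ (k : ℕ))⁻¹ • B k (fwd S y₀ (xOf N η z) k)) else 0

section basic

variable {N : ℕ} {η : ℝ} {A : ∀ k, E k ≃L[ℝ] E (k + 1)} {B : ∀ k, F k →+ E (k + 1)}
  {S : ∀ k, E k → F k → F (k + 1)} {y₀ : F 0}

omit [∀ k, NormedSpace ℝ (E k)] in
/-- `u_k` agrees with the `k`-th component. [folklore] -/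
private theorem uAt'_eq (z : ETraj E N) (k : Fin (N + 1)) : uAt' N z k = z k := dif_pos k.isLt

omit [∀ k, NormedSpace ℝ (E k)] in
/-- `u` is additive. [folklore] -/
private theorem uAt'_sub (z z' : ETraj E N) (k : ℕ) :
    uAt' N (z - z') k = uAt' N z k - uAt' N z' k := by
  unfold uAt'; split_ifs <;> simp

omit [∀ k, NormedSpace ℝ (E k)] in
/-- `‖u_k‖ ≤ ‖u‖`. [folklore] -/
private theorem norm_uAt'_le (z : ETraj E N) (k : ℕ) : ‖uAt' N z k‖ ≤ ‖z‖ := by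
  unfold uAt'
  split_ifs with h
  · exact norm_le_pi_norm z ⟨k, h⟩
  · simp

omit [∀ k, NormedSpace ℝ (E k)] in
/-- A bound on all coordinates bounds the norm. [folklore] -/
private theorem norm_le_of_forall_le' {z : ETraj E N} {C : ℝ} (hC : 0 ≤ C)
    (h : ∀ k, k ≤ N → ‖uAt' N z k‖ ≤ C) : ‖z‖ ≤ C := by
  refine (pi_norm_le_iff_of_nonneg hC).2 fun k => ?_
  have h' := h k (Nat.lt_succ_iff.1 k.isLt)
  rwa [uAt'_eq] at h'

/-- `‖x_k‖ = η^k ‖u_k‖ ≤ η^k ‖u‖` (`η ≥ 0`). [cite: AdamsBuchholzKoteckyMuller2019, Ch. 12, eq. (12.2)] -/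
theorem norm_xOf_le (hη : 0 ≤ η) (z : ETraj E N) (k : ℕ) : ‖xOf N η z k‖ ≤ η ^ k * ‖z‖ := by
  unfold xOf
  rw [norm_smul, Real.norm_of_nonneg (pow_nonneg hη _)]
  exact mul_le_mul_of_nonneg_left (norm_uAt'_le z k) (pow_nonneg hη _)

/-- `x_k(u) − x_k(u') = η^k (u_k − u'_k)` (the rescaling is linear).
[cite: AdamsBuchholzKoteckyMuller2019, Ch. 12, eq. (12.43)] -/
theorem xOf_sub (z z' : ETraj E N) (k : ℕ) : xOf N η z k - xOf N η z' k = xOf N η (z - z') k := by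
  unfold xOf; rw [uAt'_sub, smul_sub]

/-- The relevant component of `𝒯u` below the horizon. [cite: AdamsBuchholzKoteckyMuller2019, Ch. 12, eq. (12.5)] -/
theorem uAt'_redMap {z : ETraj E N} {k : ℕ} (hk : k < N) :
    uAt' N (redMap N η A B S y₀ z) k =
      (A k).symm (η • uAt' N z (k + 1) - (η ^ k)⁻¹ • B k (fwd S y₀ (xOf N η z) k)) := by
  have hk' : k < N + 1 := Nat.lt_succ_of_lt hk
  simp [uAt', redMap, hk, hk']

/-- The relevant component of `𝒯u` at the horizon vanishes (`H_N = 0`).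
[cite: AdamsBuchholzKoteckyMuller2019, Ch. 12, eq. (12.6)] -/
theorem uAt'_redMap_self (z : ETraj E N) : uAt' N (redMap N η A B S y₀ z) N = 0 := by
  simp [uAt', redMap]

end basic

/-! ## §3 The forward solution in the tube and the contraction -/

section contraction

variable {N : ℕ} {r α β σ η κ ε c₀ : ℝ} {Q : ∀ k, F k → ℝ → Prop}
  {A : ∀ k, E k ≃L[ℝ] E (k + 1)} {B : ∀ k, F k →+ E (k + 1)}
  {S : ∀ k, E k → F k → F (k + 1)} {y₀ : F 0}

/-- **The forward solution stays in the tube**: for `‖u‖ ≤ ε` (`ε ≤ r`, `σ ≤ κη`, `κ ≤ 1`,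
`‖y₀‖_0 ≤ ε`), `‖y_k(u)‖_k ≤ ε η^k` for all `k ≤ N` ([ABKM19] (12.47)).
[cite: AdamsBuchholzKoteckyMuller2019, Ch. 12, eq. (12.47)] -/
theorem fwd_bound (hQ : IsNormBound Q) (hT : IsRGStepQ N r α β σ Q A B S) (hη : 0 < η)
    (hη1 : η ≤ 1) (hκ₂ : σ ≤ κ * η) (hκ : κ ≤ 1) (hεr : ε ≤ r)
    (hy₀ : Q 0 y₀ c₀) (hc₀ : c₀ ≤ ε) {z : ETraj E N} (hz : ‖z‖ ≤ ε) :
    ∀ k, k ≤ N → Q k (fwd S y₀ (xOf N η z) k) (ε * η ^ k) := by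
  have hε : 0 ≤ ε := (norm_nonneg _).trans hz
  intro k
  induction k with
  | zero => intro _; rw [pow_zero, mul_one]; exact hQ.mono _ _ _ _ hy₀ hc₀
  | succ k ih =>
    intro hk
    have hk' : k < N := Nat.lt_of_succ_le hk
    have hyk := ih hk'.le
    have hηk : η ^ k ≤ 1 := pow_le_one₀ hη.le hη1
    have hxk : ‖xOf N η z k‖ ≤ ε * η ^ k := by
      rw [mul_comm]; exact (norm_xOf_le hη.le z k).trans (mul_le_mul_of_nonneg_left hz (pow_nonneg hη.le _))
    have hxr : ‖xOf N η z k‖ ≤ r := hxk.trans ((mul_le_of_le_one_right hε hηk).trans hεr)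
    have hcr : ε * η ^ k ≤ r := (mul_le_of_le_one_right hε hηk).trans hεr
    have h0r : (0 : ℝ) ≤ r := hε.trans hεr
    have h := hT.lipschitz k hk' (xOf N η z k) 0 (fwd S y₀ (xOf N η z) k) 0 (ε * η ^ k) 0
      (ε * η ^ k) hxr (by rw [norm_zero]; exact h0r) hyk hcr (hQ.zero k) h0r
      (by rw [sub_zero]; exact hyk)
    rw [hT.map_zero k hk', sub_zero, sub_zero] at h
    rw [fwd_succ]
    refine hQ.mono _ _ _ _ h ?_
    have hmax : max ‖xOf N η z k‖ (ε * η ^ k) = ε * η ^ k := max_eq_right hxk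
    rw [hmax, pow_succ]
    calc σ * (ε * η ^ k) ≤ κ * η * (ε * η ^ k) := mul_le_mul_of_nonneg_right hκ₂ (by positivity)
      _ ≤ 1 * η * (ε * η ^ k) := by gcongr
      _ = ε * (η ^ k * η) := by ring

/-- **Lipschitz dependence of the forward solution on the relevant trajectory**:
`‖y_k(u) − y_k(u')‖_k ≤ κ η^k ‖u − u'‖` on the `ε`-ball ([ABKM19] (12.44)).
[cite: AdamsBuchholzKoteckyMuller2019, Ch. 12, eq. (12.44)] -/
theorem fwd_lipschitz (hQ : IsNormBound Q) (hT : IsRGStepQ N r α β σ Q A B S) (hη : 0 < η)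
    (hη1 : η ≤ 1) (hκ₂ : σ ≤ κ * η) (hκ0 : 0 ≤ κ) (hκ : κ ≤ 1) (hεr : ε ≤ r)
    (hy₀ : Q 0 y₀ c₀) (hc₀ : c₀ ≤ ε) {z z' : ETraj E N} (hz : ‖z‖ ≤ ε) (hz' : ‖z'‖ ≤ ε) :
    ∀ k, k ≤ N → Q k (fwd S y₀ (xOf N η z) k - fwd S y₀ (xOf N η z') k) (κ * η ^ k * ‖z - z'‖) := by
  have hε : 0 ≤ ε := (norm_nonneg _).trans hz
  intro k
  induction k with
  | zero =>
    intro _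
    rw [fwd_zero, fwd_zero, sub_self]
    exact hQ.mono _ _ _ _ (hQ.zero 0) (by positivity)
  | succ k ih =>
    intro hk
    have hk' : k < N := Nat.lt_of_succ_le hk
    have hηk : η ^ k ≤ 1 := pow_le_one₀ hη.le hη1
    have hcr : ε * η ^ k ≤ r := (mul_le_of_le_one_right hε hηk).trans hεr
    have hx : ∀ w : ETraj E N, ‖w‖ ≤ ε → ‖xOf N η w k‖ ≤ r := fun w hw =>
      calc ‖xOf N η w k‖ ≤ η ^ k * ‖w‖ := norm_xOf_le hη.le w k
        _ ≤ η ^ k * ε := mul_le_mul_of_nonneg_left hw (pow_nonneg hη.le _)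
        _ = ε * η ^ k := mul_comm _ _
        _ ≤ r := hcr
    have h := hT.lipschitz k hk' (xOf N η z k) (xOf N η z' k) (fwd S y₀ (xOf N η z) k)
      (fwd S y₀ (xOf N η z') k) (ε * η ^ k) (ε * η ^ k) (κ * η ^ k * ‖z - z'‖) (hx z hz) (hx z' hz')
      (fwd_bound hQ hT hη hη1 hκ₂ hκ hεr hy₀ hc₀ hz k hk'.le) hcr
      (fwd_bound hQ hT hη hη1 hκ₂ hκ hεr hy₀ hc₀ hz' k hk'.le) hcr (ih hk'.le)
    rw [fwd_succ, fwd_succ]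
    refine hQ.mono _ _ _ _ h ?_
    have hdx : ‖xOf N η z k - xOf N η z' k‖ ≤ η ^ k * ‖z - z'‖ := by
      rw [xOf_sub]; exact norm_xOf_le hη.le _ k
    have hmax : max ‖xOf N η z k - xOf N η z' k‖ (κ * η ^ k * ‖z - z'‖) ≤ η ^ k * ‖z - z'‖ := by
      refine max_le hdx ?_
      calc κ * η ^ k * ‖z - z'‖ ≤ 1 * η ^ k * ‖z - z'‖ := by gcongr
        _ = η ^ k * ‖z - z'‖ := by ring
    calc σ * max ‖xOf N η z k - xOf N η z' k‖ (κ * η ^ k * ‖z - z'‖)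
        ≤ κ * η * (η ^ k * ‖z - z'‖) := mul_le_mul hκ₂ hmax (le_max_of_le_left (norm_nonneg _))
            (by positivity)
      _ = κ * η ^ (k + 1) * ‖z - z'‖ := by ring

/-- **`𝒯` maps the closed `ε`-ball into itself** (`α(η+β) ≤ κ ≤ 1`).
[cite: AdamsBuchholzKoteckyMuller2019, Ch. 12, eqs. (12.47)–(12.48)] -/
theorem norm_redMap_le (hQ : IsNormBound Q) (hT : IsRGStepQ N r α β σ Q A B S) (hη : 0 < η)
    (hη1 : η ≤ 1) (hα : 0 ≤ α) (hκ₁ : α * (η + β) ≤ κ)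
    (hκ₂ : σ ≤ κ * η) (hκ : κ ≤ 1) (hεr : ε ≤ r) (hy₀ : Q 0 y₀ c₀) (hc₀ : c₀ ≤ ε)
    {z : ETraj E N} (hz : ‖z‖ ≤ ε) : ‖redMap N η A B S y₀ z‖ ≤ ε := by
  have hε : 0 ≤ ε := (norm_nonneg _).trans hz
  refine norm_le_of_forall_le' hε fun k hk => ?_
  rcases Nat.lt_or_ge k N with hkN | hkN
  · rw [uAt'_redMap hkN]
    have hy := hT.norm_B_le k hkN _ _ (fwd_bound hQ hT hη hη1 hκ₂ hκ hεr hy₀ hc₀ hz k hkN.le)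
    have hηk : 0 < η ^ k := pow_pos hη k
    calc ‖(A k).symm (η • uAt' N z (k + 1) - (η ^ k)⁻¹ • B k (fwd S y₀ (xOf N η z) k))‖
        ≤ α * ‖η • uAt' N z (k + 1) - (η ^ k)⁻¹ • B k (fwd S y₀ (xOf N η z) k)‖ :=
          hT.norm_symm_le k hkN _
      _ ≤ α * (‖η • uAt' N z (k + 1)‖ + ‖(η ^ k)⁻¹ • B k (fwd S y₀ (xOf N η z) k)‖) :=
          mul_le_mul_of_nonneg_left (norm_sub_le _ _) hα
      _ ≤ α * (η * ε + (η ^ k)⁻¹ * (β * (ε * η ^ k))) := by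
          rw [norm_smul, norm_smul, Real.norm_of_nonneg hη.le,
            Real.norm_of_nonneg (inv_nonneg.2 hηk.le)]
          gcongr
          exact (norm_uAt'_le z (k + 1)).trans hz
      _ = α * (η + β) * ε := by
          have : (η ^ k)⁻¹ * (β * (ε * η ^ k)) = β * ε := by
            field_simp
          rw [this]; ring
      _ ≤ κ * ε := mul_le_mul_of_nonneg_right hκ₁ hε
      _ ≤ 1 * ε := mul_le_mul_of_nonneg_right hκ hε
      _ = ε := one_mul ε
  · have : k = N := le_antisymm hk hkN
    subst this
    rw [uAt'_redMap_self, norm_zero]; exact hε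

/-- **`𝒯` is a `κ`-contraction of the closed `ε`-ball** ([ABKM19] (12.43)–(12.46) with the
irrelevant coordinates eliminated). [cite: AdamsBuchholzKoteckyMuller2019, Ch. 12, eqs. (12.43)–(12.46)] -/
theorem lipschitz_redMap (hQ : IsNormBound Q) (hT : IsRGStepQ N r α β σ Q A B S) (hη : 0 < η)
    (hη1 : η ≤ 1) (hα : 0 ≤ α) (hβ : 0 ≤ β) (hκ₁ : α * (η + β) ≤ κ)
    (hκ₂ : σ ≤ κ * η) (hκ : κ ≤ 1) (hεr : ε ≤ r) (hy₀ : Q 0 y₀ c₀) (hc₀ : c₀ ≤ ε)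
    {z z' : ETraj E N} (hz : ‖z‖ ≤ ε) (hz' : ‖z'‖ ≤ ε) :
    ‖redMap N η A B S y₀ z - redMap N η A B S y₀ z'‖ ≤ κ * ‖z - z'‖ := by
  have hκ0 : 0 ≤ κ := le_trans (mul_nonneg hα (add_nonneg hη.le hβ)) hκ₁
  have hD : 0 ≤ ‖z - z'‖ := norm_nonneg _
  refine norm_le_of_forall_le' (mul_nonneg hκ0 hD) fun k hk => ?_
  rw [uAt'_sub]
  rcases Nat.lt_or_ge k N with hkN | hkN
  · rw [uAt'_redMap hkN, uAt'_redMap hkN, ← map_sub]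
    have hηk : 0 < η ^ k := pow_pos hη k
    have hdy := hT.norm_B_le k hkN _ _
      (fwd_lipschitz hQ hT hη hη1 hκ₂ hκ0 hκ hεr hy₀ hc₀ hz hz' k hkN.le)
    have hdu : ‖uAt' N z (k + 1) - uAt' N z' (k + 1)‖ ≤ ‖z - z'‖ := by
      rw [← uAt'_sub]; exact norm_uAt'_le _ _
    have heq : η • uAt' N z (k + 1) - (η ^ k)⁻¹ • B k (fwd S y₀ (xOf N η z) k) -
        (η • uAt' N z' (k + 1) - (η ^ k)⁻¹ • B k (fwd S y₀ (xOf N η z') k)) =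
        η • (uAt' N z (k + 1) - uAt' N z' (k + 1)) -
          (η ^ k)⁻¹ • B k (fwd S y₀ (xOf N η z) k - fwd S y₀ (xOf N η z') k) := by
      rw [map_sub, smul_sub, smul_sub]; abel
    calc ‖(A k).symm (η • uAt' N z (k + 1) - (η ^ k)⁻¹ • B k (fwd S y₀ (xOf N η z) k) -
          (η • uAt' N z' (k + 1) - (η ^ k)⁻¹ • B k (fwd S y₀ (xOf N η z') k)))‖
        ≤ α * ‖η • (uAt' N z (k + 1) - uAt' N z' (k + 1)) -
            (η ^ k)⁻¹ • B k (fwd S y₀ (xOf N η z) k - fwd S y₀ (xOf N η z') k)‖ := by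
          rw [heq]; exact hT.norm_symm_le k hkN _
      _ ≤ α * (‖η • (uAt' N z (k + 1) - uAt' N z' (k + 1))‖ +
            ‖(η ^ k)⁻¹ • B k (fwd S y₀ (xOf N η z) k - fwd S y₀ (xOf N η z') k)‖) :=
          mul_le_mul_of_nonneg_left (norm_sub_le _ _) hα
      _ ≤ α * (η * ‖z - z'‖ + (η ^ k)⁻¹ * (β * (κ * η ^ k * ‖z - z'‖))) := by
          rw [norm_smul, norm_smul, Real.norm_of_nonneg hη.le,
            Real.norm_of_nonneg (inv_nonneg.2 hηk.le)]
          gcongr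
      _ = α * (η + β * κ) * ‖z - z'‖ := by
          have : (η ^ k)⁻¹ * (β * (κ * η ^ k * ‖z - z'‖)) = β * κ * ‖z - z'‖ := by
            field_simp
          rw [this]; ring
      _ ≤ α * (η + β * 1) * ‖z - z'‖ := by gcongr
      _ ≤ κ * ‖z - z'‖ := by rw [mul_one]; exact mul_le_mul_of_nonneg_right hκ₁ hD
  · have : k = N := le_antisymm hk hkN
    subst this
    rw [uAt'_redMap_self, uAt'_redMap_self, sub_zero, norm_zero]
    exact mul_nonneg hκ0 hD

end contraction

/-! ## §4 The tuned trajectory -/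

section existence

variable {N : ℕ} {r α β σ η κ ε c₀ : ℝ} {Q : ∀ k, F k → ℝ → Prop}
  {A : ∀ k, E k ≃L[ℝ] E (k + 1)} {B : ∀ k, F k →+ E (k + 1)}
  {S : ∀ k, E k → F k → F (k + 1)} {y₀ : F 0}

/-- A fixed point of `𝒯` is a tuned relevant trajectory: `x_N = 0` and
`x_{k+1} = A_k x_k + B_k y_k(x)` for `k < N`. [cite: AdamsBuchholzKoteckyMuller2019, Ch. 12, (12.9)] -/
theorem isTuned_of_fixedPt (hη : 0 < η) {z : ETraj E N} (hfix : redMap N η A B S y₀ z = z) :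
    xOf N η z N = 0 ∧
      ∀ k, k < N → xOf N η z (k + 1) = A k (xOf N η z k) + B k (fwd S y₀ (xOf N η z) k) := by
  refine ⟨?_, fun k hk => ?_⟩
  · unfold xOf
    rw [← hfix, uAt'_redMap_self, smul_zero]
  · have hηk : (η ^ k : ℝ) ≠ 0 := pow_ne_zero _ hη.ne'
    have hu : uAt' N z k = (A k).symm (η • uAt' N z (k + 1) - (η ^ k)⁻¹ • B k (fwd S y₀ (xOf N η z) k)) := by
      conv_lhs => rw [← hfix]
      exact uAt'_redMap hk
    have hA : A k (uAt' N z k) = η • uAt' N z (k + 1) - (η ^ k)⁻¹ • B k (fwd S y₀ (xOf N η z) k) := by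
      rw [hu, ContinuousLinearEquiv.apply_symm_apply]
    show η ^ (k + 1) • uAt' N z (k + 1) = A k (η ^ k • uAt' N z k) + B k (fwd S y₀ (xOf N η z) k)
    rw [ContinuousLinearEquiv.map_smul, hA, smul_sub, smul_smul, smul_smul, mul_inv_cancel₀ hηk,
      one_smul, pow_succ, mul_comm (η ^ k) η, ← smul_smul]
    abel

/-- **The fine-tuning theorem with norm-bound predicates** ([ABKM19] Thm 12.1, existence; [Bry09]
Thm 2.16).  Under `IsNormBound Q`, `IsRGStepQ N r α β σ Q A B S`, `0 < η ≤ 1`, `α, β, σ ≥ 0`,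
`α(η+β) ≤ κ`, `σ ≤ κη`, `κ < 1`, `0 ≤ ε ≤ r` and an initial irrelevant coordinate with
`‖y₀‖_0 ≤ c₀ ≤ ε`: there is a relevant trajectory `x` with `x_N = 0`,
`x_{k+1} = A_k x_k + B_k y_k` for the forward solution `y = fwd S y₀ x` (`y_0 = y₀`,
`y_{k+1} = S_k(x_k, y_k)`), and `‖x_k‖ ≤ ε η^k`, `‖y_k‖_k ≤ ε η^k` for `k ≤ N`.
[cite: AdamsBuchholzKoteckyMuller2019, Thm 12.1] -/
theorem exists_tuned_of_normBound [∀ k, CompleteSpace (E k)] (hQ : IsNormBound Q) (hT : IsRGStepQ N r α β σ Q A B S)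
    (hη : 0 < η) (hη1 : η ≤ 1) (hα : 0 ≤ α) (hβ : 0 ≤ β) (hκ₁ : α * (η + β) ≤ κ)
    (hκ₂ : σ ≤ κ * η) (hκ : κ < 1) (hε : 0 ≤ ε) (hεr : ε ≤ r) (hy₀ : Q 0 y₀ c₀) (hc₀ : c₀ ≤ ε) :
    ∃ x : ∀ k, E k, x N = 0 ∧
      (∀ k, k < N → x (k + 1) = A k (x k) + B k (fwd S y₀ x k)) ∧
      ∀ k, k ≤ N → ‖x k‖ ≤ ε * η ^ k ∧ Q k (fwd S y₀ x k) (ε * η ^ k) := by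
  have hκ0 : 0 ≤ κ := le_trans (mul_nonneg hα (add_nonneg hη.le hβ)) hκ₁
  obtain ⟨z, hzε, hfix, -, -⟩ :=
    exists_fixedPt_of_lipschitz_of_norm_le (T := redMap N η A B S y₀) hκ0 hκ hε
      (fun z z' hz hz' => lipschitz_redMap hQ hT hη hη1 hα hβ hκ₁ hκ₂ hκ.le hεr hy₀ hc₀ hz hz')
      (fun z hz => norm_redMap_le hQ hT hη hη1 hα hκ₁ hκ₂ hκ.le hεr hy₀ hc₀ hz)
  obtain ⟨hN, hrec⟩ := isTuned_of_fixedPt (A := A) (B := B) (S := S) (y₀ := y₀) hη hfix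
  refine ⟨xOf N η z, hN, hrec, fun k hk => ⟨?_, ?_⟩⟩
  · rw [mul_comm]
    exact (norm_xOf_le hη.le z k).trans (mul_le_mul_of_nonneg_left hzε (pow_nonneg hη.le _))
  · exact fwd_bound hQ hT hη hη1 hκ₂ hκ.le hεr hy₀ hc₀ hzε k hk

end existence

end RGFlow

end Literature.Dynamics.Hyperbolic

end
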